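import Summits.AtomisticToContinuum.HydrodynamicLimit.Theorems.MourreKoopmanChargesStressStrongMixingGibbsMoments
import Summits.AtomisticToContinuum.HydrodynamicLimit.Theorems.MourreKoopmanChargesOneBodySectorRigidity
import Literature.Analysis.FluidPDE.InfiniteHardSphereKoopman
import Literature.MathematicalPhysics.StatisticalMechanics.LowActivityHardSphereGibbsUniqueness
import Literature.MathematicalPhysics.StatisticalMechanics.DiluteHardSphereGasProofs
import Literature.Analysis.FunctionSpaces.PointConfigKernel
import Mathlib.Probability.IdentDistrib
import HarnessLib

/-!
# `OneBodyCompleteness` · line `registered`, stub `stub_flowMeanSquareContinuity` (part 1 of 2):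
# toolkit — measurable membership, transport of cell observables, initial free flight, null faces,
# Vitali along a measure-preserving family

Support file for the crux item stmt-AtomisticToContinuum-9583 (`OneBodyCompleteness`, route
`MourreKoopmanCharges` of `AtomisticToContinuum/HydrodynamicLimit`), line `registered`
(`Cruxes/OneBodyCompleteness/Lines/birth.lean`, skeleton v7), registered stub
`stub_flowMeanSquareContinuity` — hypothesis (D2) of the landed reduction `dynamicClusteringOneBody_of`:
for every unit-diameter equilibrium flow `Φ`, every DLR state `G` of unit hard spheres at unit inverse
temperature and every continuous polynomially bounded `h`,

  `∫ (A_h ∘ Φ_t - A_h)² dG → 0` as `t → 0⁺`, `A_h(ω) = Σ_{(q,v) ∈ ω, q ∈ [0,1)³} h(v)`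

(Doyon's strong continuity of the dynamics on the GNS space, Doyon 2022 Thm 4.11, for the one-body cell
observables).  The stub is CLOSED in the sequel `…FlowContinuityB.lean` by a STATIONARITY COUNT using only
the structure axioms of `InfiniteHardSphereFlow` and stationarity (no uniform regularity of Alexander's
solutions).  This file is the toolkit; no new definitions (all sets are written out).

## Contents

* MEASURABLE MEMBERSHIP (`measurableSet_mem_config`): `{a | x a ∈ g a}` is measurable for measurable `x`
  into phase space and `g` into configurations — a parametrised count `N_{g a}({x a}) ≠ 0` of the section
  of the measurable graph `{(a, y) | y = x a}` by the s-finite counting kernel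
  (`PointConfig.measurable_toMeasure_preimage`).  Arithmetic of counts (`enat_le_of_not_one_le_sub`).
* TRANSPORT OF CELL OBSERVABLES (`cellObs_eq_of_inter_eq_image`): `A_h(ω)` is the `finsum` of `h(v)` over
  `ω ∩ [0,1)³ × ℝ³` (sibling `OneBodySectorRigidity.cellObs_eq_finsum_mem`); if `ω' ∩ [0,1)³ × ℝ³` is the
  image of `ω ∩ [0,1)³ × ℝ³` under
  the (injective) free flight `f_t(q, v) = (q + t v, v)`, then `A_h(ω') = A_h(ω)` for every `h`.
* INITIAL FREE FLIGHT (`eventually_traj_eq_freeFlight`): for a good `ω` and `p ∈ ω`,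
  `traj ω p t = f_t(p)` for all small `t ≥ 0` — the collision times of `p` in `(0, 1]` are finitely many
  (`locFinite` on the compact range of its continuous position; Alexander 1976 Def. 4.8 (a)), then `free`
  and `traj_zero`.  A particle starting in the OPEN cube stays in it for small times.
* NULL FACES (`volume_cubeFaces`, `gibbsWeight_faceEvent`, `measure_faceEvent`): the faces
  `{∃ i, qᵢ ∈ {0, 1}}` are Lebesgue-null (`Measure.pi_hyperplane` via `PiLp.volume_preserving_ofLp`), so
  by the DLR equation in the window `B(0, 4)` the event "a particle over a face inside `B(0, 4)`" is null
  for EVERY hard-sphere Gibbs state: the grand-canonical weight vanishes for every boundary condition (the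
  thrown particles avoid a `Measure.pi`-null set, `Measure.pi_eval_preimage_null`; boundary particles lie
  outside the window).  Off that event the particles over `[0,1)³` are in the open cube.  Packing: a.s.
  `N_{[0,1)³ × ℝ³} ≤ 8` (`count_unitCube_le_of_isHardCore`).
* VITALI ALONG A MEASURE-PRESERVING FAMILY (`tendsto_integral_sq_sub_of_measure_tendsto_zero`): maps `T i`
  preserving a probability measure, `A ∈ L²` measurable with `A ∘ T i = A` off measurable events of
  probability `→ 0` along a filter; the `A ∘ T i` are identically distributed, so `{A ∘ T i - A}` is
  uniformly integrable in `L²` (`MemLp.uniformIntegrable_of_identDistrib`, `UnifIntegrable.sub`) and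
  `∫ (A ∘ T i - A)² → 0`.

References: B. Doyon, Comm. Math. Phys. 391 (2022), §4.3 Thm 4.11; R. Alexander, Comm. Math. Phys. 49
(1976), §2.1, §4.2, Def. 4.8 (a), Thm 5.2; H. Spohn, *Large Scale Dynamics of Interacting Particles* (1991),
Part I §7.1.
-/

noncomputable section

open MeasureTheory ProbabilityTheory Filter Topology Set
open scoped ENNReal

namespace Summit.AtomisticToContinuum.HydrodynamicLimit.Theorems.MourreKoopmanChargesOneBodyCompleteness

open Literature.MathematicalPhysics.KineticTheory Literature.Analysis.FluidPDE
open Literature.Analysis.FunctionSpaces (PointConfig)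

namespace FlowContinuity

variable {σ : ℝ}

/-! ### Measurable membership; arithmetic of counts -/

/-- **Membership of a measurably parametrised phase point in a measurably parametrised configuration is
a measurable relation** (`{x(a) ∈ g(a)} = {N_{g a}({x a}) ≠ 0}`, a parametrised count of the section of
the measurable graph `{(a, y) | y = x a}`; s-finite counting kernel). [folklore] -/
theorem measurableSet_mem_config {α : Type*} [MeasurableSpace α] {x : α → V3 × V3} (hx : Measurable x)
    {g : α → MarkedConfig} (hg : Measurable g) : MeasurableSet {a | x a ∈ g a} := by
  have hD : MeasurableSet {r : α × (V3 × V3) | r.2 = x r.1} :=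
    measurableSet_eq_fun measurable_snd (hx.comp measurable_fst)
  have hm := PointConfig.measurable_toMeasure_preimage hD hg
  have hsec : ∀ a, Prod.mk a ⁻¹' {r : α × (V3 × V3) | r.2 = x r.1} = {x a} := fun a => by
    ext y
    simp
  have e : {a | x a ∈ g a} =
      (fun a => (g a).toMeasure (Prod.mk a ⁻¹' {r : α × (V3 × V3) | r.2 = x r.1})) ⁻¹' {0}ᶜ := by
    ext a
    rw [mem_preimage, mem_compl_iff, mem_singleton_iff, hsec,
      PointConfig.toMeasure_apply _ (measurableSet_singleton _), ENat.toENNReal_eq_zero, PointConfig.count,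
      encard_eq_zero, inter_singleton_eq_empty, mem_setOf_eq, PointConfig.mem_carrier, not_not]
  rw [e]
  exact hm (measurableSet_singleton 0).compl

/-- Arithmetic of the bad events: for counts `m, n ∈ ℕ∞`, if NOT `1 ≤ n - m` (in `[0, ∞]`) then `n ≤ m`.
[folklore] -/
theorem enat_le_of_not_one_le_sub {m n : ℕ∞} (h : ¬ (1 : ℝ≥0∞) ≤ (n : ℝ≥0∞) - m) : n ≤ m := by
  rw [← ENat.toENNReal_sub, ← ENat.toENNReal_one, ENat.toENNReal_le, not_le, Order.lt_one_iff] at h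
  exact tsub_eq_zero_iff_le.1 h

/-! ### Transport of the cell observables by free flight -/

/-- Free flight `(q, v) ↦ (q + t v, v)` is injective on phase space. [folklore] -/
theorem freeFlight_injective (t : ℝ) : Function.Injective fun p : V3 × V3 => (p.1 + t • p.2, p.2) := by
  intro p q h
  simp only [Prod.mk.injEq] at h
  obtain ⟨h1, h2⟩ := h
  rw [h2] at h1
  exact Prod.ext (add_right_cancel h1) h2

/-- Free flight is measurable. [folklore] -/
theorem measurable_freeFlight (t : ℝ) : Measurable fun p : V3 × V3 => (p.1 + t • p.2, p.2) :=
  ((continuous_fst.add (continuous_snd.const_smul t)).prodMk continuous_snd).measurable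

/-- **Transport**: if the particles of `ω'` over the cell are the free flights of those of `ω`, the cell
observables agree (`A_h` is a `finsum` over the cell points, `OneBodySectorRigidity.cellObs_eq_finsum_mem`;
free flight keeps velocities; `finsum` over an injective image). [folklore] -/
theorem cellObs_eq_of_inter_eq_image {ω ω' : MarkedConfig} {t : ℝ}
    (he : (ω' : Set (V3 × V3)) ∩ Prod.fst ⁻¹' unitCell =
      (fun p : V3 × V3 => (p.1 + t • p.2, p.2)) '' ((ω : Set (V3 × V3)) ∩ Prod.fst ⁻¹' unitCell))
    (h : V3 → ℝ) : cellObs h ω' = cellObs h ω := by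
  rw [OneBodySectorRigidity.cellObs_eq_finsum_mem, OneBodySectorRigidity.cellObs_eq_finsum_mem, he,
    finsum_mem_image (freeFlight_injective t).injOn]

/-! ### Initial free flight of every particle of a good configuration -/

/-- The open unit cube `(0,1)³` is open. [folklore] -/
theorem isOpen_openCube : IsOpen {q : V3 | ∀ i, q i ∈ Ioo (0 : ℝ) 1} := by
  have e : {q : V3 | ∀ i, q i ∈ Ioo (0 : ℝ) 1} = ⋂ i : Fin 3, (fun q : V3 => q i) ⁻¹' Ioo (0 : ℝ) 1 := by
    ext q
    simp
  rw [e]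
  exact isOpen_iInter_of_finite fun i => isOpen_Ioo.preimage (PiLp.continuous_apply 2 (fun _ : Fin 3 => ℝ) i)

/-- A freely flying particle starting in the open cube stays in it for small times. [folklore] -/
theorem eventually_freeFlight_fst_mem_openCube {p : V3 × V3} (hp : p.1 ∈ {q : V3 | ∀ i, q i ∈ Ioo (0 : ℝ) 1}) :
    ∀ᶠ t in 𝓝 (0 : ℝ), p.1 + t • p.2 ∈ {q : V3 | ∀ i, q i ∈ Ioo (0 : ℝ) 1} := by
  have hc : Continuous fun t : ℝ => p.1 + t • p.2 := continuous_const.add (continuous_id.smul continuous_const)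
  have ht : Tendsto (fun t : ℝ => p.1 + t • p.2) (𝓝 0) (𝓝 p.1) := by
    simpa using hc.tendsto 0
  exact ht.eventually_mem (isOpen_openCube.mem_nhds hp)

/-- **Initial free flight of every particle of a good configuration**: the collision times of `p` in
`(0, 1]` are finitely many (Alexander's 4.8 (a) on the compact range of the continuous position of `p`),
so for all small `t ≥ 0` the particle has not collided in `(0, t]` and `traj ω p t = (q + t v, v)`
(`free`, `traj_zero`). [cite: Alexander1976, §4.2 and Def. 4.8 (a)] -/
theorem eventually_traj_eq_freeFlight (Φ : InfiniteHardSphereFlow (Fin 3) σ) {ω : MarkedConfig}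
    (hω : ω ∈ Φ.good) {p : V3 × V3} (hp : p ∈ ω) :
    ∀ᶠ t in 𝓝[≥] (0 : ℝ), Φ.traj ω p t = (p.1 + t • p.2, p.2) := by
  have hT := Φ.isTrajectory ω hω
  have hpS : p ∈ (ω : Set (V3 × V3)) := hp
  obtain ⟨r, hr⟩ : ∃ r : ℝ, ∀ τ ∈ Icc (0 : ℝ) 1, ‖(Φ.traj ω p τ).1‖ ≤ r := by
    obtain ⟨r, hr⟩ := isCompact_Icc.bddAbove_image
      ((hT.pos_continuous p hpS).norm.continuousOn (s := Icc (0 : ℝ) 1))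
    exact ⟨r, fun τ hτ => hr ⟨τ, hτ, rfl⟩⟩
  set E : Set ℝ := {τ | τ ∈ Ioc (0 : ℝ) 1 ∧ (p, τ) ∈ collisionEvents σ (ω : Set (V3 × V3)) (Φ.traj ω)}
    with hE_def
  have hE : E.Finite := by
    refine ((hT.locFinite r 0 1).image Prod.snd).subset fun τ hτ => ?_
    exact ⟨(p, τ), ⟨hτ.2, hr τ (Ioc_subset_Icc_self hτ.1), Ioc_subset_Icc_self hτ.1⟩, rfl⟩
  have h1 : ∀ᶠ t in 𝓝[≥] (0 : ℝ), ∀ τ ∈ E, t < τ :=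
    hE.eventually_all.2 fun τ hτ => mem_nhdsWithin_of_mem_nhds (Iio_mem_nhds hτ.1.1)
  have h2 : ∀ᶠ t in 𝓝[≥] (0 : ℝ), t ∈ Icc (0 : ℝ) 1 := Icc_mem_nhdsGE one_pos
  filter_upwards [h1, h2] with t ht ht'
  have hfree := hT.free p hpS 0 t ht'.1 fun τ hτ hcol =>
    lt_irrefl t ((ht τ ⟨⟨hτ.1, hτ.2.trans ht'.2⟩, hcol⟩).trans_le hτ.2)
  rw [hfree, Φ.traj_zero ω hω p hp, sub_zero]

/-! ### Null faces: almost surely no particle sits on a face of the unit cube -/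

/-- Coordinate hyperplanes of `ℝ³` are Lebesgue-null. [folklore] -/
theorem volume_coord_eq (i : Fin 3) (c : ℝ) : volume {q : V3 | q i = c} = 0 := by
  have e : {q : V3 | q i = c} = (WithLp.ofLp : V3 → Fin 3 → ℝ) ⁻¹' {f | f i = c} := by
    ext q
    simp
  rw [e, (PiLp.volume_preserving_ofLp (Fin 3)).measure_preimage
    (measurableSet_eq_fun (measurable_pi_apply i) measurable_const).nullMeasurableSet, volume_pi]
  exact Measure.pi_hyperplane (fun _ : Fin 3 => (volume : Measure ℝ)) i c

/-- The faces `{∃ i, qᵢ ∈ {0, 1}}` of the integer unit cube through the cell, as a finite union of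
coordinate hyperplanes. [folklore] -/
theorem cubeFaces_eq :
    {q : V3 | ∃ i, q i = 0 ∨ q i = 1} = ⋃ i : Fin 3, ({q : V3 | q i = 0} ∪ {q : V3 | q i = 1}) := by
  ext q
  simp

/-- The faces are measurable. [folklore] -/
theorem measurableSet_cubeFaces : MeasurableSet {q : V3 | ∃ i, q i = 0 ∨ q i = 1} := by
  rw [cubeFaces_eq]
  refine MeasurableSet.iUnion fun i => ?_
  have hc : Continuous fun q : V3 => q i := PiLp.continuous_apply 2 (fun _ : Fin 3 => ℝ) i
  exact (isClosed_eq hc continuous_const).measurableSet.union (isClosed_eq hc continuous_const).measurableSet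

/-- The faces are Lebesgue-null. [folklore] -/
theorem volume_cubeFaces : volume {q : V3 | ∃ i, q i = 0 ∨ q i = 1} = 0 := by
  rw [cubeFaces_eq, measure_iUnion_null_iff]
  exact fun i => measure_union_null (volume_coord_eq i 0) (volume_coord_eq i 1)

/-- The face event "some particle has its position on a face, inside the window `B(0, 4)`" is measurable.
[folklore] -/
theorem measurableSet_faceEvent : MeasurableSet {ω : MarkedConfig |
    ω.count (Prod.fst ⁻¹' ({q : V3 | ∃ i, q i = 0 ∨ q i = 1} ∩ Metric.ball (0 : V3) 4)) ≠ 0} :=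
  PointConfig.measurable_count ((measurableSet_cubeFaces.inter measurableSet_ball).preimage measurable_fst)
    (measurableSet_singleton 0).compl

/-- The one-particle a priori measure does not charge the faces. [folklore] -/
theorem maxwellPhaseMeasure_fst_preimage_cubeFaces (β : ℝ) (u : V3) (Λ : Set V3) :
    maxwellPhaseMeasure β u Λ (Prod.fst ⁻¹' {q : V3 | ∃ i, q i = 0 ∨ q i = 1}) = 0 := by
  unfold maxwellPhaseMeasure
  rw [← prod_univ, Measure.prod_prod, Measure.restrict_apply measurableSet_cubeFaces,
    measure_inter_null_of_null_left _ volume_cubeFaces, zero_mul]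

/-- **The grand-canonical weight of the face event vanishes** for every boundary condition: the thrown
particles have positions off the `Measure.pi`-null faces, and the boundary particles lie outside the
window `B(0, 4)`. [folklore] -/
theorem gibbsWeight_faceEvent (σ z β : ℝ) (u : V3) (Y : MarkedConfig) :
    gibbsWeight σ z β u (Metric.ball (0 : V3) 4) Y {ω : MarkedConfig |
      ω.count (Prod.fst ⁻¹' ({q : V3 | ∃ i, q i = 0 ∨ q i = 1} ∩ Metric.ball (0 : V3) 4)) ≠ 0} = 0 := by
  unfold gibbsWeight
  refine ENNReal.tsum_eq_zero.2 fun k => ?_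
  haveI : SigmaFinite (maxwellPhaseMeasure β u (Metric.ball (0 : V3) 4)) := by
    unfold maxwellPhaseMeasure
    infer_instance
  have hnull : Measure.pi (fun _ : Fin k => maxwellPhaseMeasure β u (Metric.ball (0 : V3) 4))
      (⋃ i : Fin k, Function.eval i ⁻¹' (Prod.fst ⁻¹' {q : V3 | ∃ i, q i = 0 ∨ q i = 1})) = 0 :=
    (measure_iUnion_null_iff).2 fun i =>
      Measure.pi_eval_preimage_null _ (maxwellPhaseMeasure_fst_preimage_cubeFaces β u _)
  refine mul_eq_zero_of_right _ ((lintegral_congr_ae ?_).trans lintegral_zero)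
  filter_upwards [compl_mem_ae_iff.2 hnull] with x hx
  refine indicator_of_notMem (fun hmem => hx ?_) _
  obtain ⟨p, hp, hpF⟩ : ((superposeIn (Metric.ball (0 : V3) 4) x Y).carrier ∩
      Prod.fst ⁻¹' ({q : V3 | ∃ i, q i = 0 ∨ q i = 1} ∩ Metric.ball (0 : V3) 4)).Nonempty := by
    rw [nonempty_iff_ne_empty]
    intro he
    exact hmem.1 (by rw [PointConfig.count, he, encard_empty])
  rcases hp with ⟨⟨i, rfl⟩, -⟩ | ⟨-, hout⟩
  · exact mem_iUnion.2 ⟨i, hpF.1⟩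
  · exact absurd hpF.2 hout

/-- **Almost surely no particle sits on a face of the unit cube** (inside `B(0, 4)`), for every
hard-sphere Gibbs state (DLR equation in the window `B(0, 4)`). [folklore] -/
theorem measure_faceEvent {σ z β : ℝ} {u : V3} {G : Measure MarkedConfig} (hG : IsHardSphereGibbs σ z β u G) :
    G {ω : MarkedConfig |
      ω.count (Prod.fst ⁻¹' ({q : V3 | ∃ i, q i = 0 ∨ q i = 1} ∩ Metric.ball (0 : V3) 4)) ≠ 0} = 0 := by
  rw [hG.2 (Metric.ball (0 : V3) 4) measurableSet_ball Metric.isBounded_ball _ measurableSet_faceEvent]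
  have h0 : ∀ Y, gibbsSpec σ z β u (Metric.ball (0 : V3) 4) Y {ω : MarkedConfig |
      ω.count (Prod.fst ⁻¹' ({q : V3 | ∃ i, q i = 0 ∨ q i = 1} ∩ Metric.ball (0 : V3) 4)) ≠ 0} = 0 :=
    fun Y => by rw [gibbsSpec, gibbsWeight_faceEvent, ENNReal.zero_div]
  simp only [h0, lintegral_zero]

/-- **Registered sub-goal `flowContinuity_nullFaces` of the stub `stub_flowMeanSquareContinuity`** (the
`∀`-form of `measure_faceEvent`): under every hard-sphere Gibbs state, almost surely no particle has its
position on a face `{∃ i, qᵢ ∈ {0, 1}}` of the unit cube inside the window `B(0, 4)`. [folklore] -/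
theorem flowContinuity_nullFaces :
    ∀ (σ z β : ℝ) (u : V3) (G : Measure MarkedConfig), IsHardSphereGibbs σ z β u G →
      G {ω : MarkedConfig |
        ω.count (Prod.fst ⁻¹' ({q : V3 | ∃ i, q i = 0 ∨ q i = 1} ∩ Metric.ball (0 : V3) 4)) ≠ 0} = 0 :=
  fun _ _ _ _ _ hG => measure_faceEvent hG

/-- Off the face event, a particle over the cell has its position in the open cube. [folklore] -/
theorem fst_mem_openCube_of_count_faces_eq_zero {ω : MarkedConfig}
    (hω : ω.count (Prod.fst ⁻¹' ({q : V3 | ∃ i, q i = 0 ∨ q i = 1} ∩ Metric.ball (0 : V3) 4)) = 0)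
    {p : V3 × V3} (hp : p ∈ ω) (hpC : p.1 ∈ unitCell) : p.1 ∈ {q : V3 | ∀ i, q i ∈ Ioo (0 : ℝ) 1} := by
  rw [PointConfig.count, encard_eq_zero] at hω
  have hball : p.1 ∈ Metric.ball (0 : V3) 4 := by
    rw [Metric.mem_ball, dist_zero_right]
    exact (norm_le_of_mem_unitCell hpC).trans_lt (by norm_num)
  have hnf : p.1 ∉ {q : V3 | ∃ i, q i = 0 ∨ q i = 1} := fun h' => by
    have : p ∈ ω.carrier ∩ Prod.fst ⁻¹' ({q : V3 | ∃ i, q i = 0 ∨ q i = 1} ∩ Metric.ball (0 : V3) 4) :=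
      ⟨hp, h', hball⟩
    rw [hω] at this
    exact this
  intro i
  exact ⟨(hpC i).1.lt_of_ne fun h' => hnf ⟨i, Or.inl h'.symm⟩, (hpC i).2⟩

/-- **Packing bound**: under a DLR state of unit hard spheres, a.s. at most `8` particles lie over the
unit cell (`count_unitCube_le_of_isHardCore`). [folklore] -/
theorem count_cell_le_eight_ae {z β : ℝ} {u : V3} {G : Measure MarkedConfig} (hG : IsHardSphereGibbs 1 z β u G) :
    ∀ᵐ ω ∂G, ((ω.count (Prod.fst ⁻¹' unitCell) : ℕ∞) : ℝ≥0∞) ≤ 8 := by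
  filter_upwards [hG.ae_isHardCore] with ω hω
  have h : ω.count (Prod.fst ⁻¹' unitCell) ≤ 8 :=
    Literature.MathematicalPhysics.StatisticalMechanics.count_unitCube_le_of_isHardCore hω
  calc ((ω.count (Prod.fst ⁻¹' unitCell) : ℕ∞) : ℝ≥0∞) ≤ ((8 : ℕ∞) : ℝ≥0∞) := ENat.toENNReal_le.2 h
    _ = 8 := rfl

/-! ### Vitali along a measure-preserving family -/

/-- The integral of the square of an `L²` function is the square of its `L²` norm. [folklore] -/
theorem integral_sq_eq_toReal_eLpNorm_sq {X : Type*} [MeasurableSpace X] {μ : Measure X} {f : X → ℝ}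
    (hf : MemLp f 2 μ) : ∫ x, f x ^ 2 ∂μ = (eLpNorm f 2 μ).toReal ^ 2 := by
  have h := hf.eLpNorm_eq_integral_rpow_norm two_ne_zero ENNReal.ofNat_ne_top
  have hI : ∫ a, ‖f a‖ ^ (2 : ℝ≥0∞).toReal ∂μ = ∫ a, f a ^ 2 ∂μ := by
    refine integral_congr_ae (ae_of_all _ fun a => ?_)
    simp only [ENNReal.toReal_ofNat, Real.rpow_two, Real.norm_eq_abs, sq_abs]
  have hnn : 0 ≤ ∫ a, f a ^ 2 ∂μ := integral_nonneg fun a => sq_nonneg _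
  rw [h, hI, ENNReal.toReal_ofReal (Real.rpow_nonneg hnn _), ENNReal.toReal_ofNat]
  have h2 := Real.rpow_inv_natCast_pow (n := 2) hnn two_ne_zero
  rw [Nat.cast_ofNat] at h2
  exact h2.symm

/-- **Vitali along a measure-preserving family.** If the maps `T i` preserve the probability measure `μ`,
`A ∈ L²(μ)` is measurable and `A ∘ T i = A` off measurable events `s i` with `μ (s i) → 0` along `l`, then
`∫ (A ∘ T i - A)² dμ → 0` along `l`: the `A ∘ T i` are identically distributed, so `{A ∘ T i - A}` is
uniformly integrable in `L²` (`MemLp.uniformIntegrable_of_identDistrib`, `UnifIntegrable.sub`), and each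
member is its own restriction to `s i`. [folklore] -/
theorem tendsto_integral_sq_sub_of_measure_tendsto_zero {X : Type*} [MeasurableSpace X] {μ : Measure X}
    [IsProbabilityMeasure μ] {ι : Type*} {l : Filter ι} {T : ι → X → X}
    (hT : ∀ i, MeasurePreserving (T i) μ μ) {A : X → ℝ} (hA : Measurable A) (hA2 : MemLp A 2 μ)
    (s : ι → Set X) (hsm : ∀ i, MeasurableSet (s i)) (hs : ∀ i x, x ∉ s i → A (T i x) = A x)
    (hμs : Tendsto (fun i => μ (s i)) l (𝓝 0)) :
    Tendsto (fun i => ∫ x, (A (T i x) - A x) ^ 2 ∂μ) l (𝓝 0) := by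
  rcases isEmpty_or_nonempty ι with hι | ⟨⟨j⟩⟩
  · rw [filter_eq_bot_of_isEmpty l]
    exact tendsto_bot
  set D : ι → X → ℝ := fun i x => A (T i x) - A x with hD_def
  have hD2 : ∀ i, MemLp (D i) 2 μ := fun i => (hA2.comp_measurePreserving (hT i)).sub hA2
  have hUI1 : UnifIntegrable (fun i x => A (T i x)) 2 μ := by
    refine (MemLp.uniformIntegrable_of_identDistrib (f := fun i x => A (T i x)) (j := j) one_le_two
      ENNReal.ofNat_ne_top (hA2.comp_measurePreserving (hT j)) fun i => ?_).unifIntegrable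
    refine ⟨(hA.comp (hT i).measurable).aemeasurable, (hA.comp (hT j).measurable).aemeasurable, ?_⟩
    change Measure.map (A ∘ T i) μ = Measure.map (A ∘ T j) μ
    rw [← Measure.map_map hA (hT i).measurable, (hT i).map_eq, ← Measure.map_map hA (hT j).measurable,
      (hT j).map_eq]
  have hUI : UnifIntegrable D 2 μ :=
    hUI1.sub (unifIntegrable_const one_le_two ENNReal.ofNat_ne_top hA2) one_le_two
      (fun i => (hA.comp (hT i).measurable).aestronglyMeasurable) fun _ => hA.aestronglyMeasurable
  have hsupp : ∀ i, (s i).indicator (D i) = D i := fun i =>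
    indicator_eq_self.2 fun x hx => by_contra fun hxs => hx (sub_eq_zero.2 (hs i x hxs))
  rw [tendsto_order]
  refine ⟨fun a ha => Eventually.of_forall fun i => ha.trans_le (integral_nonneg fun x => sq_nonneg _),
    fun ε hε => ?_⟩
  obtain ⟨δ, hδ, hδ'⟩ := hUI (Real.sqrt_pos.2 (half_pos hε))
  filter_upwards [hμs.eventually (eventually_le_nhds (ENNReal.ofReal_pos.2 hδ))] with i hi
  have h1 : eLpNorm (D i) 2 μ ≤ ENNReal.ofReal (Real.sqrt (ε / 2)) := by
    rw [← hsupp i]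
    exact hδ' i (s i) (hsm i) hi
  have h2 : (eLpNorm (D i) 2 μ).toReal ≤ Real.sqrt (ε / 2) :=
    ENNReal.toReal_le_of_le_ofReal (Real.sqrt_nonneg _) h1
  calc ∫ x, (A (T i x) - A x) ^ 2 ∂μ = (eLpNorm (D i) 2 μ).toReal ^ 2 :=
        integral_sq_eq_toReal_eLpNorm_sq (hD2 i)
    _ ≤ Real.sqrt (ε / 2) ^ 2 := pow_le_pow_left₀ ENNReal.toReal_nonneg h2 2
    _ = ε / 2 := Real.sq_sqrt (half_pos hε).le
    _ < ε := half_lt_self hε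

end FlowContinuity

end Summit.AtomisticToContinuum.HydrodynamicLimit.Theorems.MourreKoopmanChargesOneBodyCompleteness

end
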